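import Mathlib
import Summits.QuantumFields.BalabanUV.T4Continuum.Support.SliceTorusBlocks

/-!
# T⁴ programme, node NE3 (η-rate of the minimisers) — the slice-operator TORUS MODEL, supplement:
# the UNIT-FACE SKELETON of the level-`k` torus and its codimension-one shell count

Eleventh generation of the NE3 prover lineage P1 of the cell `pub-balaban` (technique: implicit-function / fixed-point
structure of the one-step constrained variational problem, Bałaban CMP 102 (1985) = "B11", Sect. E, read as the DISCRETE
implicit-function theorem = STABILITY × CONSISTENCY).  The four-file series `SliceTorusBlocks` → `SliceTorusBlockModel`
→ `SliceTorusTower` → `SliceTorusSkeleton` (tenth generation) states NE3's typed skeleton end to end on Bałaban's own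
carrier, `SliceTorusSkeleton.ne3Shape_torus_of_printedStatements`, with the consistency-side FACE SETS `F k` and their
three geometry binders left free:

* `hFN : ∀ k x, ∀ y ∈ F k, npl1 (x − y) ≤ Nn k` and `hN : ∀ k, Nn k ≤ ℓ·L^k` (the faces lie within `ℓ` unit blocks),
* `hcard : ∀ k x r, 1 ≤ r → #{y ∈ F k : npl1 (x − y) = r} ≤ A_f·r^{d−2}` (a CODIMENSION-ONE shell count, level-free
  `A_f`) — the binders of `T4TwoSpacingDefect.layer_sum_le` / `T4SliceTelescoping.ne3Shape_of_slices_rpow`, whose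
  dictionary reads [model] «`F` = the unit faces», «the unit-face skeleton has `≤ A·r^{d−2}` sites on the shell of
  radius `r` about any point, `A` depending on `d` and the torus side `ℓ` in unit blocks».

THIS FILE DISCHARGES THEM [model geometry, proved; integer arithmetic on `ℤ/T` and finite counting]: §1 the diameter
bound `npl1 w ≤ d·T` on `(ℤ/T)^d` (each minimal representative is at most `T/2`), hence `Nn k := d·(N·L^k)`,
`ℓ := d·N`; §2 **the hyperplane sphere count** `card_hyperplane_sphere_le`: on a coordinate hyperplane `{y_i = c}` of
`(ℤ/T)^d`, `d ≥ 2`, at most `3·(2r+1)^{d−2}` points lie at integer periodic ℓ¹ distance exactly `r` from any point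
`x`, UNIFORMLY in `T` and `c` — the minimal-representative vector of `x − y` has its `i`-th coordinate pinned by the
hyperplane, and is recovered from its coordinates off `i` and one further direction `i′` together with the SIGN of its
`i′`-coordinate, the modulus being fixed by the sphere condition (`Int.sign_mul_natAbs`; injection into a box of
`1·3·(2r+1)^{d−2}` points, `vmaVec_injective`); §3 the UNIT-FACE SKELETON `faceSkel d k N L` of the level-`k` torus
`(ℤ/N·L^k)^d` — the sites with some coordinate a multiple of `L^k`, i.e. on a lower face of their unit block (side
`L^k` lattice units = `1` in the units `η = L^{−k}`; `mem_faceSkel_iff_dvd`), the union of the `d·N` coordinate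
hyperplanes `{y_i = m·L^k}`, `m < N` — with the level-free shell count `card_faceSkel_shell_le`:
`#{y ∈ faceSkel : npl1 (x − y) = r} ≤ faceConst d N · r^{d−2}`, `faceConst d N = d·N·3·3^{d−2}`, for `r ≥ 1`; §4 the
arithmetic of the remaining two binders (`faces_hN`: `d·(N·L^k) ≤ (d·N)·L^k`; `faces_hℓ`: `1 ≤ d·N`) — so that
`npl1_le`, `faces_hN`, `card_faceSkel_shell_le`, `faceConst_nonneg`, `faces_hℓ` are exactly the binders `hFN`, `hN`,
`hcard`, `hAf`, `hℓ` of `ne3Shape_torus_of_printedStatements` with `F := fun k => faceSkel d k N L`,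
`Nn := fun k => d·(N·L^k)` (the instantiated skeleton is the sequel `SliceTorusFacesSkeleton`, importing file 4).

## What is printed and located ([R] = certified wordings; NOTHING of it enters as a hypothesis here)

* [R] B12 = Bałaban, *Renormalization group approach to lattice gauge field theories. I*, CMP 109 (1987) 249–301, p. 251
  [certified wording of the header of `B12Decay510Torus`]: «a torus T obtained by the usual identification of boundary
  points of the cube {x ∈ R^d : −L_μ ≦ x_μ ≦ L_μ, μ = 1, …, d}» — the periodic carrier `(ℤ/T)^d = TreeLengthTorus.TPt`
  with the periodic ℓ¹ length `B12Decay510Torus.pl1` (`SliceTorusBlocks.npl1` its integer copy, `cast_npl1`).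
* [R] B9 = Bałaban, *Propagators for lattice gauge theories in a background field*, CMP 99 (1985) 389–434, p. 397
  [certified wording in the docstring of `B9.Geometry`, quoted in file 1 of the series]: «if y ∈ Λ_j, then Δ(y) = B^j(y),
  and Δ̃(y) is a cube of the size 2L^jη on the lattice T_η with center at the point y» — the nested block structure; the
  UNIT blocks are the level-`k` blocks `B^k`, side `L^k` lattice units.
* [model, located — the lineage records `t4/T4-EST-U1b-OSC.md` §4/§5, not print]: the consistency reading `dl k V`
  (= `sup_x Σ_{y ∈ faces} |∇_yG_k(x,y)|`, the absolute layer sum of the two-grid truncation dipole layer on the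
  unit-face skeleton) is what the binders `hdl`, `hFN`, `hN`, `hcard` of the skeleton serve; that the layer lives on
  the unit faces is the DEFINITION of the two-grid comparison [model], and this file only supplies the counting.

Honest framing: finite-T⁴ ultraviolet bookkeeping about MINIMISERS (rung (B)+1 of the cell's ladder); no conditional of
the cell (`BetaPertH`, (B), (B^μ)) is used or hidden; nothing bears on infinite volume, a mass gap, or the Clay problem;
NE3 is NOT proved — after this file the hypotheses of the skeleton are the ANALYTIC readings only (stability: the
printed family statements `B9.Thm31Printed` / `B9.Stmt349Printed` holding for Bałaban's auxiliary propagators, the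
identifications `hA0 hA1 hF3 hK`, `hbd`; consistency: `hdl h1 h3 h4 h5 ht hosc hread hresp hpair`).  ABSOLUTE RULE of
the cell kept: no internally-minted statement enters as a cited fact; the manuscripts under audit are not cited for any
disputed step.  No `sorry`, no axioms beyond Mathlib's; every statement is [folklore] counting / [model] dictionary.
PLACEMENT (human rule 2026-08-19): cell work under `Summits/QuantumFields/BalabanUV/`; imports file 1 of the series
(`Support.SliceTorusBlocks`, p195254) and moves nothing.  Records: `t4/T4-EST-U1b-OSC.md` v1.23 (RESULT 30),
`t4/T4-EST-NE3-P1.md` v2.21, GAPS G-ne3p1-37 of the cell `pub-balaban` (HOME `run/shared/lean/pub/pub-balaban/`).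
-/

noncomputable section

open Finset Real

namespace Summit.QuantumFields.BalabanUV.T4Continuum.SliceTorusFaces

open Literature.MathematicalPhysics.QuantumFieldTheory.Balaban1983to89
open Literature.MathematicalPhysics.QuantumFieldTheory.Balaban1983to89.TreeLengthTorus (TPt)
open Literature.MathematicalPhysics.QuantumFieldTheory.Balaban1983to89.B12Decay510Torus (vmaVec vmaVec_injective)
open Summit.QuantumFields.BalabanUV.T4Continuum.SliceTorusBlocks (npl1)

/-! ## §1  The diameter of `(ℤ/T)^d` in the integer periodic ℓ¹ length (binders `Nn`, `hFN`, `hN`) -/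
section Diameter

variable {d T : ℕ}

/-- Every coordinate of the minimal representative is at most `T/2 ≤ T` in absolute value, so the integer periodic ℓ¹
length of any point of `(ℤ/T)^d` is at most `d·T`. [folklore] -/
theorem npl1_le [NeZero T] (w : TPt d T) : npl1 w ≤ d * T := by
  unfold npl1
  calc ∑ i, (w i).valMinAbs.natAbs ≤ ∑ _i : Fin d, T :=
        Finset.sum_le_sum fun i _ => (ZMod.natAbs_valMinAbs_le (w i)).trans (Nat.div_le_self T 2)
    _ = d * T := by rw [Finset.sum_const, Finset.card_univ, Fintype.card_fin, smul_eq_mul]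

end Diameter

/-! ## §2  Spheres on a coordinate hyperplane of `(ℤ/T)^d`: at most `3(2r+1)^{d−2}` points, uniformly in `T` -/
section Hyperplane

variable {d T : ℕ}

/-- **The hyperplane sphere count.**  On a coordinate hyperplane `{y : y_i = c}` of the torus `(ℤ/T)^d`, `d ≥ 2`, at
most `3·(2r+1)^{d−2}` points lie at integer periodic ℓ¹ distance exactly `r` from a given point `x` — uniformly in `T`
and `c`.  Proof: `y ↦ ` the minimal-representative vector of `x − y` with coordinate `i` replaced by `0` and coordinate
`i′ ≠ i` replaced by its sign is injective on the sphere (coordinate `i` is pinned by the hyperplane, the modulus of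
coordinate `i′` by the sphere condition) into a box of `1·3·(2r+1)^{d−2}` integer points. [folklore] -/
theorem card_hyperplane_sphere_le [NeZero T] (hd : 2 ≤ d) (x : TPt d T) (i : Fin d) (c : ZMod T) (r : ℕ) :
    (Finset.univ.filter fun y : TPt d T => y i = c ∧ npl1 (x - y) = r).card ≤ 3 * (2 * r + 1) ^ (d - 2) := by
  haveI : Nontrivial (Fin d) := Fin.nontrivial_iff_two_le.2 hd
  obtain ⟨i', hi'⟩ := exists_ne i
  set S := Finset.univ.filter fun y : TPt d T => y i = c ∧ npl1 (x - y) = r with hS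
  -- the box: coordinate `i` pinned to `0`, coordinate `i'` a sign, the others in `[−r, r]`
  set t : Fin d → Finset ℤ :=
    Function.update (Function.update (fun _ : Fin d => Finset.Icc (-(r : ℤ)) r) i {0}) i' (Finset.Icc (-1) 1)
    with ht
  -- the comparison map
  set φ : TPt d T → (Fin d → ℤ) := fun y =>
    Function.update (Function.update (vmaVec (x - y)) i 0) i' (Int.sign ((x - y) i').valMinAbs) with hφ
  -- on the sphere every coordinate of the minimal representative of `x − y` is at most `r` in absolute value
  have hco : ∀ y ∈ S, ∀ j, ((x - y) j).valMinAbs.natAbs ≤ r := by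
    intro y hy j
    have hy' : npl1 (x - y) = r := (Finset.mem_filter.1 hy).2.2
    rw [← hy', npl1]
    exact Finset.single_le_sum (f := fun j => ((x - y) j).valMinAbs.natAbs) (fun _ _ => Nat.zero_le _)
      (Finset.mem_univ j)
  have hmaps : Set.MapsTo φ ↑S ↑(Fintype.piFinset t) := by
    intro y hy
    rw [Finset.mem_coe] at hy
    rw [Finset.mem_coe, Fintype.mem_piFinset]
    intro j
    simp only [hφ, ht]
    by_cases hji : j = i
    · rw [hji, Function.update_of_ne (Ne.symm hi'), Function.update_of_ne (Ne.symm hi'), Function.update_self,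
        Function.update_self, Finset.mem_singleton]
    · by_cases hji' : j = i'
      · rw [hji', Function.update_self, Function.update_self, Finset.mem_Icc]
        rcases Int.sign_trichotomy ((x - y) i').valMinAbs with h | h | h <;> rw [h] <;> omega
      · rw [Function.update_of_ne hji', Function.update_of_ne hji, Function.update_of_ne hji',
          Function.update_of_ne hji, Finset.mem_Icc]
        have := hco y hy j
        simp only [vmaVec]
        constructor <;> omega
  have hinj : Set.InjOn φ ↑S := by
    intro y hy y' hy' hyy'
    rw [Finset.mem_coe] at hy hy'
    have e : ∀ j, φ y j = φ y' j := fun j => congrFun hyy' j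
    -- coordinates off `i, i'` are read off `φ`
    have hoff : ∀ j, j ≠ i → j ≠ i' → ((x - y) j).valMinAbs = ((x - y') j).valMinAbs := by
      intro j hji hji'
      have := e j
      simp only [hφ, Function.update_of_ne hji', Function.update_of_ne hji, vmaVec] at this
      exact this
    -- coordinate `i` is pinned by the hyperplane
    have hii : ((x - y) i).valMinAbs = ((x - y') i).valMinAbs := by
      have h1 : y i = c := (Finset.mem_filter.1 hy).2.1
      have h2 : y' i = c := (Finset.mem_filter.1 hy').2.1
      simp only [Pi.sub_apply, h1, h2]
    -- the modulus of coordinate `i'` is fixed by the two sphere conditions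
    have habs : ((x - y) i').valMinAbs.natAbs = ((x - y') i').valMinAbs.natAbs := by
      have hs : ∀ z ∈ S, ∑ j, ((x - z) j).valMinAbs.natAbs = r := fun z hz => (Finset.mem_filter.1 hz).2.2
      have key : ∀ z : TPt d T, ((x - z) i').valMinAbs.natAbs
          + ∑ j ∈ Finset.univ.erase i', ((x - z) j).valMinAbs.natAbs = ∑ j, ((x - z) j).valMinAbs.natAbs :=
        fun z => Finset.add_sum_erase Finset.univ (fun j => ((x - z) j).valMinAbs.natAbs) (Finset.mem_univ i')
      have hrest : ∑ j ∈ Finset.univ.erase i', ((x - y) j).valMinAbs.natAbs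
          = ∑ j ∈ Finset.univ.erase i', ((x - y') j).valMinAbs.natAbs := by
        refine Finset.sum_congr rfl fun j hj => ?_
        have hji' : j ≠ i' := Finset.ne_of_mem_erase hj
        by_cases hji : j = i
        · rw [hji, hii]
        · rw [hoff j hji hji']
      have h1 := hs y hy
      have h2 := hs y' hy'
      rw [← key] at h1 h2
      omega
    -- the sign of coordinate `i'` is read off `φ`; sign and modulus give the coordinate
    have hsign : Int.sign ((x - y) i').valMinAbs = Int.sign ((x - y') i').valMinAbs := by
      have := e i'
      simp only [hφ, Function.update_self] at this
      exact this
    have hi'eq : ((x - y) i').valMinAbs = ((x - y') i').valMinAbs := by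
      rw [← Int.sign_mul_natAbs ((x - y) i').valMinAbs, ← Int.sign_mul_natAbs ((x - y') i').valMinAbs, hsign,
        habs]
    have hv : vmaVec (x - y) = vmaVec (x - y') := by
      funext j
      simp only [vmaVec]
      by_cases hji : j = i
      · rw [hji]; exact hii
      · by_cases hji' : j = i'
        · rw [hji']; exact hi'eq
        · exact hoff j hji hji'
    exact sub_right_injective (vmaVec_injective hv)
  have hcard : S.card ≤ (Fintype.piFinset t).card := Finset.card_le_card_of_injOn φ hmaps hinj
  -- the box has `(2r+1)^{d−2}·(1·3)` points
  have ht_i : (t i).card = 1 := by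
    rw [ht, Function.update_of_ne (Ne.symm hi'), Function.update_self, Finset.card_singleton]
  have ht_i' : (t i').card = 3 := by
    rw [ht, Function.update_self, Int.card_Icc]; rfl
  have hIcc : (Finset.Icc (-(r : ℤ)) r).card = 2 * r + 1 := by
    rw [Int.card_Icc]
    have : (r : ℤ) + 1 - -(r : ℤ) = ((2 * r + 1 : ℕ) : ℤ) := by push_cast; ring
    rw [this, Int.toNat_natCast]
  have hsd : ∀ j ∈ (Finset.univ \ {i, i'} : Finset (Fin d)), (t j).card = 2 * r + 1 := by
    intro j hj
    rw [Finset.mem_sdiff, Finset.mem_insert, Finset.mem_singleton, not_or] at hj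
    rw [ht, Function.update_of_ne hj.2.2, Function.update_of_ne hj.2.1, hIcc]
  have hbox : (Fintype.piFinset t).card = 3 * (2 * r + 1) ^ (d - 2) := by
    rw [Fintype.card_piFinset, ← Finset.prod_sdiff (Finset.subset_univ ({i, i'} : Finset (Fin d))),
      Finset.prod_pair (Ne.symm hi'), ht_i, ht_i', Finset.prod_congr rfl hsd, Finset.prod_const,
      Finset.card_univ_sdiff, Finset.card_pair (Ne.symm hi'), Fintype.card_fin]
    ring
  exact hcard.trans hbox.le

end Hyperplane

/-! ## §3  The unit-face skeleton of the level-`k` torus `(ℤ/N·L^k)^d` and its shell count -/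
section Faces

variable {d k N L : ℕ}

/-- **The unit-face skeleton** of the level-`k` torus `(ℤ/N·L^k)^d` [model]: the sites lying on a LOWER FACE of their
unit block (blocks of side `L^k` lattice units, `N` per direction) — the union of the `d·N` coordinate hyperplanes
`{y : y_i = m·L^k}`, `i < d`, `m < N`.  Dictionary: the consistency layer (`T4TwoSpacingDefect.layer_sum_le`: «`F` =
the unit faces») lives here. [model] [folklore] -/
def faceSkel (d k N L : ℕ) [NeZero N] [NeZero L] : Finset (TPt d (N * L ^ k)) :=
  Finset.univ.biUnion fun i : Fin d => (Finset.range N).biUnion fun m =>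
    Finset.univ.filter fun y : TPt d (N * L ^ k) => y i = ((m * L ^ k : ℕ) : ZMod (N * L ^ k))

/-- Membership, unfolded. [folklore] -/
theorem mem_faceSkel [NeZero N] [NeZero L] {y : TPt d (N * L ^ k)} :
    y ∈ faceSkel d k N L ↔ ∃ i : Fin d, ∃ m < N, y i = ((m * L ^ k : ℕ) : ZMod (N * L ^ k)) := by
  simp [faceSkel]

/-- **Dictionary**: a site lies on the unit-face skeleton iff one of its coordinates is a multiple of `L^k` (it is on
the lower face, in that direction, of its unit block). [model] [folklore] -/
theorem mem_faceSkel_iff_dvd [NeZero N] [NeZero L] {y : TPt d (N * L ^ k)} :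
    y ∈ faceSkel d k N L ↔ ∃ i : Fin d, L ^ k ∣ (y i).val := by
  rw [mem_faceSkel]
  have hLk : 0 < L ^ k := pow_pos (Nat.pos_of_ne_zero (NeZero.ne L)) k
  refine exists_congr fun i => ⟨?_, ?_⟩
  · rintro ⟨m, hm, hy⟩
    have hlt : m * L ^ k < N * L ^ k := by nlinarith
    rw [hy, ZMod.val_natCast, Nat.mod_eq_of_lt hlt]
    exact dvd_mul_left _ _
  · rintro ⟨q, hq⟩
    have hlt : (y i).val < N * L ^ k := ZMod.val_lt (y i)
    refine ⟨q, ?_, ?_⟩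
    · by_contra h
      have h' : N ≤ q := Nat.le_of_not_lt h
      have : N * L ^ k ≤ L ^ k * q := by rw [Nat.mul_comm N (L ^ k)]; exact Nat.mul_le_mul_left _ h'
      omega
    · rw [← ZMod.natCast_zmod_val (y i), hq, Nat.mul_comm (L ^ k) q]

/-- The shell count of the skeleton, in `ℕ`: at most `d·N·3·(2r+1)^{d−2}` skeleton sites at integer periodic ℓ¹
distance exactly `r` from any point (union of `d·N` hyperplane spheres, §2). [folklore] -/
theorem card_faceSkel_shell_le_nat [NeZero N] [NeZero L] (hd : 2 ≤ d) (x : TPt d (N * L ^ k)) (r : ℕ) :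
    ((faceSkel d k N L).filter fun y => npl1 (x - y) = r).card ≤ d * N * (3 * (2 * r + 1) ^ (d - 2)) := by
  have hi : ∀ i ∈ (Finset.univ : Finset (Fin d)),
      (((Finset.range N).biUnion fun m => Finset.univ.filter fun y : TPt d (N * L ^ k) =>
          y i = ((m * L ^ k : ℕ) : ZMod (N * L ^ k))).filter fun y => npl1 (x - y) = r).card
        ≤ N * (3 * (2 * r + 1) ^ (d - 2)) := by
    intro i _
    have hm : ∀ m ∈ Finset.range N,
        ((Finset.univ.filter fun y : TPt d (N * L ^ k) => y i = ((m * L ^ k : ℕ) : ZMod (N * L ^ k))).filter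
            fun y => npl1 (x - y) = r).card ≤ 3 * (2 * r + 1) ^ (d - 2) := by
      intro m _
      rw [Finset.filter_filter]
      exact card_hyperplane_sphere_le hd x i _ r
    rw [Finset.filter_biUnion]
    calc _ ≤ ∑ m ∈ Finset.range N, ((Finset.univ.filter fun y : TPt d (N * L ^ k) =>
            y i = ((m * L ^ k : ℕ) : ZMod (N * L ^ k))).filter fun y => npl1 (x - y) = r).card :=
          Finset.card_biUnion_le
      _ ≤ ∑ _m ∈ Finset.range N, 3 * (2 * r + 1) ^ (d - 2) := Finset.sum_le_sum hm
      _ = N * (3 * (2 * r + 1) ^ (d - 2)) := by rw [Finset.sum_const, Finset.card_range, smul_eq_mul]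
  rw [faceSkel, Finset.filter_biUnion]
  calc _ ≤ ∑ i : Fin d, (((Finset.range N).biUnion fun m => Finset.univ.filter fun y : TPt d (N * L ^ k) =>
          y i = ((m * L ^ k : ℕ) : ZMod (N * L ^ k))).filter fun y => npl1 (x - y) = r).card :=
        Finset.card_biUnion_le
    _ ≤ ∑ _i : Fin d, N * (3 * (2 * r + 1) ^ (d - 2)) := Finset.sum_le_sum hi
    _ = d * N * (3 * (2 * r + 1) ^ (d - 2)) := by
        rw [Finset.sum_const, Finset.card_univ, Fintype.card_fin, smul_eq_mul, mul_assoc]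

/-- The level-free SHELL CONSTANT of the unit-face skeleton, `A_f = d·N·3·3^{d−2}` (the binder `Af`). [folklore] -/
def faceConst (d N : ℕ) : ℝ := (d : ℝ) * N * (3 * 3 ^ (d - 2))

/-- Binder `hAf`: `0 ≤ A_f`. [folklore] -/
theorem faceConst_nonneg : 0 ≤ faceConst d N := by
  unfold faceConst; positivity

/-- **Binder `hcard` of the skeleton theorem for the unit-face skeleton**: for `r ≥ 1`,
`#{y ∈ faceSkel : npl1 (x − y) = r} ≤ A_f·r^{d−2}`, `A_f = faceConst d N` LEVEL-FREE (`(2r+1)^{d−2} ≤ (3r)^{d−2}`).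
[folklore] -/
theorem card_faceSkel_shell_le [NeZero N] [NeZero L] (hd : 2 ≤ d) (x : TPt d (N * L ^ k)) (r : ℕ) (hr : 1 ≤ r) :
    (((faceSkel d k N L).filter fun y => npl1 (x - y) = r).card : ℝ) ≤ faceConst d N * (r : ℝ) ^ (d - 2) := by
  have h := card_faceSkel_shell_le_nat (k := k) (N := N) (L := L) hd x r
  have h' : (((faceSkel d k N L).filter fun y => npl1 (x - y) = r).card : ℝ)
      ≤ ((d * N * (3 * (2 * r + 1) ^ (d - 2)) : ℕ) : ℝ) := by exact_mod_cast h
  have hr' : (1 : ℝ) ≤ r := by exact_mod_cast hr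
  have hpow : (2 * (r : ℝ) + 1) ^ (d - 2) ≤ (3 : ℝ) ^ (d - 2) * (r : ℝ) ^ (d - 2) := by
    rw [← mul_pow]
    exact pow_le_pow_left₀ (by positivity) (by linarith) _
  calc _ ≤ ((d * N * (3 * (2 * r + 1) ^ (d - 2)) : ℕ) : ℝ) := h'
    _ = (d : ℝ) * N * 3 * (2 * (r : ℝ) + 1) ^ (d - 2) := by push_cast; ring
    _ ≤ (d : ℝ) * N * 3 * ((3 : ℝ) ^ (d - 2) * (r : ℝ) ^ (d - 2)) :=
        mul_le_mul_of_nonneg_left hpow (by positivity)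
    _ = faceConst d N * (r : ℝ) ^ (d - 2) := by unfold faceConst; ring

end Faces

/-! ## §4  The arithmetic of the binders `hN`, `hℓ` of `SliceTorusSkeleton.ne3Shape_torus_of_printedStatements`
for `Nn := fun k => d·(N·L^k)`, `ℓ := d·N` (`hFN` is `npl1_le`, `hcard` is `card_faceSkel_shell_le`, `hAf` is
`faceConst_nonneg`) -/
section Binders

variable (d N L : ℕ)

/-- Binder `hN`: `Nn k = d·(N·L^k) ≤ ℓ·L^k` with `ℓ = d·N` (equality). [folklore] -/
theorem faces_hN : ∀ k : ℕ, ((d * (N * L ^ k) : ℕ) : ℝ) ≤ ((d : ℝ) * N) * (L : ℝ) ^ k := by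
  intro k
  push_cast
  exact le_of_eq (by ring)

/-- Binder `hℓ`: `1 ≤ ℓ = d·N` (`d ≥ 2`, `N ≥ 1`). [folklore] -/
theorem faces_hℓ [NeZero N] (hd : 2 ≤ d) : (1 : ℝ) ≤ (d : ℝ) * N := by
  have h1 : (1 : ℝ) ≤ d := by exact_mod_cast (by omega : 1 ≤ d)
  have h2 : (1 : ℝ) ≤ N := by exact_mod_cast Nat.one_le_iff_ne_zero.2 (NeZero.ne N)
  nlinarith

/-- Sanity [folklore]: on `(ℤ/6)^2` (`d = 2`, `N = 3`, `L = 2`, `k = 1`) the site `(2, 5)` is on the skeleton (first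
coordinate a multiple of `L^k = 2`) and `(1, 5)` is not. -/
example : (fun j : Fin 2 => if j = 0 then (2 : ZMod (3 * 2 ^ 1)) else 5) ∈ faceSkel 2 1 3 2 := by
  rw [mem_faceSkel]; exact ⟨0, 1, by norm_num, by decide⟩

example : (fun j : Fin 2 => if j = 0 then (1 : ZMod (3 * 2 ^ 1)) else 5) ∉ faceSkel 2 1 3 2 := by
  rw [mem_faceSkel]; decide

end Binders

end Summit.QuantumFields.BalabanUV.T4Continuum.SliceTorusFaces
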